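import Summits.BirchSwinnertonDyer.BirchSwinnertonDyer.Theses.LeadingTerm
import Summits.BirchSwinnertonDyer.BirchSwinnertonDyer.Theses.Squeeze
import Summits.BirchSwinnertonDyer.BirchSwinnertonDyer.Theses.HigherGrossZagier
import Summits.BirchSwinnertonDyer.BirchSwinnertonDyer.Theses.SelmerRank
import Summits.BirchSwinnertonDyer.BirchSwinnertonDyer.Theses.PAdicOrderV2
import Summits.BirchSwinnertonDyer.BirchSwinnertonDyer.Theorems.LeadingTermSqueezeUBR2StubTransport
import Literature.NumberTheory.EllipticCurves.KatoRankBound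
import HarnessLib

/-!
# BirchSwinnertonDyer — crux `SqueezeUB` / `SqueezeUBR2` (stmt-BirchSwinnertonDyer-0145),
# line `Sketch`: what the crux is EXACTLY, and the sufficient forms of its open cell

Crux (`Summit.BirchSwinnertonDyer.BirchSwinnertonDyer.Theses.Squeeze.SqueezeUB` =
`…HigherGrossZagier.SqueezeUB` = `…LeadingTerm.SqueezeUBR2`, byte-identical): **no excess rank**,
`rank_ℤ E(ℚ) ≤ ord_{s=1} L(E,s)` for every elliptic `E/ℚ`.

* `squeezeUB_iff_cells` (registered sub-goal of line `Sketch`, skeleton v2): the crux is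
  EQUIVALENT, unconditionally, to the conjunction of its two cells on globally minimal models —
  (GZK-cell) `r_an ≤ 1 → rank ≤ r_an`, a theorem in print (Gross–Zagier 1986 + Kolyvagin 1990;
  Kato 2004 Thm 14.2 at `r_an = 0`; tree fact `rank_eq_analyticRank_of_analyticRank_le_one`, not
  yet discharged) and (UB3-cell) `3 ≤ rank → 2 ≤ r_an → rank ≤ r_an`, OPEN (first cell
  `(rank, r_an) = (3, 2)`). `←` uses the FLOOR `rank ≤ 2 ≤ r_an` (free) and transport along a
  global minimal model (landed stub TR, `stub_squeezeUB_transport`).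
* Sufficient forms of the open cell, each the weakest typed statement of its kind:
  `squeezeUB_ub3_of_sel3` (ONE prime with `corank_{ℤ_p} Sel_{p^∞} ≤ r_an` suffices, by the PROVED
  corank identity `mordellWeilRank_le_selmerCorank`); `squeezeUB_sel3_of_selmerRank_items` (that Selmer cap
  follows from route SelmerRank's cruxes stmt-0130 ∧ stmt-14418); `squeezeUB_sel3_of_katoHalf` (… and from
  the ∀-closure of Kato's corank bound, Thm 18.4, with modularity and ONE odd good ordinary prime
  where `ord_T L_p ≤ r_an`), `squeezeUB_wcl3_of_comparison` (that prime is supplied by route PAdicOrderV2's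
  crux stmt-0489), `squeezeUB_mod_of_fact` (modularity from the tree fact `exists_isNewformOf`); and the
  parity ratchet `squeezeUB_ub3_of_parity_of_ub4` (given Mordell–Weil parity — route Squeeze's crux
  `SqueezeParity`, `squeezeUB_parity_of_squeezeParity` — only `rank ≥ 4` remains).

References: Kato, Astérisque 295 (2004), Thm 18.4; Greenberg, LNM 1716 (1999), §1; Mazur–Tate–
Teitelbaum, Invent. Math. 84 (1986), §II.10; Darmon, CBMS 101 (2004), Thm 3.22.
-/

set_option linter.dupNamespace false

namespace Summit.BirchSwinnertonDyer.BirchSwinnertonDyer.Theorems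

open scoped MatrixGroups ModularForm
open CongruenceSubgroup Literature.NumberTheory.EllipticCurves
  Literature.NumberTheory.EllipticCurves.ModularForms WeierstrassCurve
open Summit.BirchSwinnertonDyer.BirchSwinnertonDyer.Theses.Squeeze (SqueezeUB SqueezeParity)
open Summit.BirchSwinnertonDyer.BirchSwinnertonDyer.Theses.LeadingTerm (SqueezeUBR2)
open Summit.BirchSwinnertonDyer.BirchSwinnertonDyer.Theses.SelmerRank (SelmerRankUB
  SelmerRankSmallImage)
open Summit.BirchSwinnertonDyer.BirchSwinnertonDyer.Theses.PAdicOrderV2 (PAdicOrderKatoSideR2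
  PAdicOrderComparisonR2)

/-- Reduction to globally minimal models (unconditional after the landed stub TR): the crux follows
from its restriction to globally minimal Weierstrass equations, since every elliptic `W/ℚ` has a
global minimal model `C • W` (`hasGlobalMinimalModel_rat_holds`, Silverman AEC VIII.8.3) with the
same rank and analytic rank (`stub_squeezeUB_transport`). [folklore] -/
theorem squeezeUB_of_isGloballyMinimal
    (h : ∀ (W : WeierstrassCurve ℚ) [W.IsElliptic] [W.IsGloballyMinimal],
      W.mordellWeilRank ≤ W.analyticRank) :
    ∀ (W : WeierstrassCurve ℚ) [W.IsElliptic], W.mordellWeilRank ≤ W.analyticRank := by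
  -- conclusion spelled out (it IS the crux, `Iff.rfl`) rather than by a crux name: this is a
  -- reduction lemma, not a proof of the crux
  intro W _
  obtain ⟨C, hC⟩ := WeierstrassCurve.hasGlobalMinimalModel_rat_holds W
  have hmin := h (C • W)
  rw [(stub_squeezeUB_transport W C).1, (stub_squeezeUB_transport W C).2] at hmin
  exact hmin

/-! ### The stubs are EXACTLY the crux (unconditional) -/

/-- **What the crux is, exactly.** `SqueezeUB` is EQUIVALENT to the conjunction of its two cells
on globally minimal models: (GZK-cell) `r_an ≤ 1 → rank ≤ r_an` — a theorem in print
(Gross–Zagier–Kolyvagin) not yet in the tree — and (UB3-cell) `3 ≤ rank → 2 ≤ r_an → rank ≤ r_an`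
— open. `→` is restriction; `←` is the floor `rank ≤ 2 ≤ r_an` plus transport along a global
minimal model (landed stub TR). Unconditional. [folklore] -/
theorem squeezeUB_iff_cells :
    SqueezeUB ↔
      ((∀ (W : WeierstrassCurve ℚ) [W.IsElliptic] [W.IsGloballyMinimal],
          W.analyticRank ≤ 1 → W.mordellWeilRank ≤ W.analyticRank) ∧
        ∀ (W : WeierstrassCurve ℚ) [W.IsElliptic] [W.IsGloballyMinimal],
          3 ≤ W.mordellWeilRank → 2 ≤ W.analyticRank → W.mordellWeilRank ≤ W.analyticRank) := by
  constructor
  · intro h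
    exact ⟨fun W _ _ _ => h W, fun W _ _ _ _ => h W⟩
  · rintro ⟨hGZK, hUB3⟩
    refine squeezeUB_of_isGloballyMinimal (fun W _ _ => ?_)
    by_cases h : W.analyticRank ≤ 1
    · exact hGZK W h
    · by_cases h3 : 3 ≤ W.mordellWeilRank
      · exact hUB3 W h3 (by omega)
      · omega

/-! ### Sufficient forms of the open cell UB3 -/

/-- `rank_ℤ E(ℚ) ≤ corank_{ℤ_p} Sel_{p^∞}(E/ℚ)` at every prime `p`, from the corank identity
`corank Sel_{p^∞} = rank + corank Ш[p^∞]` (Greenberg LNM 1716 §1 pp. 54–57), a tree THEOREM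
(`WeierstrassCurve.selmerCorank_eq_mordellWeilRank_add_holds`). [cite: Greenberg1999LNM, §1] -/
theorem mordellWeilRank_le_selmerCorank (W : WeierstrassCurve ℚ) [W.IsElliptic] (p : ℕ)
    [Fact p.Prime] : W.mordellWeilRank ≤ W.selmerCorank p := by
  have h : W.selmerCorank p = W.mordellWeilRank + W.shaCorank p :=
    W.selmerCorank_eq_mordellWeilRank_add_holds p
  omega

/-- **UB3 from the one-prime Selmer cap SEL3**: if every globally minimal `E` with `rank ≥ 3` and
`r_an ≥ 2` has ONE prime `p` with `corank_{ℤ_p} Sel_{p^∞}(E/ℚ) ≤ r_an`, then UB3 holds, by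
`rank ≤ corank Sel_{p^∞}` (`mordellWeilRank_le_selmerCorank`). Unconditional. [folklore] -/
theorem squeezeUB_ub3_of_sel3
    (hSEL : ∀ (W : WeierstrassCurve ℚ) [W.IsElliptic] [W.IsGloballyMinimal],
      3 ≤ W.mordellWeilRank → 2 ≤ W.analyticRank →
        ∃ (p : ℕ) (_ : Fact p.Prime), W.selmerCorank p ≤ W.analyticRank) :
    ∀ (W : WeierstrassCurve ℚ) [W.IsElliptic] [W.IsGloballyMinimal],
      3 ≤ W.mordellWeilRank → 2 ≤ W.analyticRank → W.mordellWeilRank ≤ W.analyticRank := by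
  intro W _ _ h3 h2
  obtain ⟨p, hp, hle⟩ := hSEL W h3 h2
  exact (mordellWeilRank_le_selmerCorank W p).trans hle

/-- **SEL3 from route SelmerRank's items** `SelmerRankUB` (stmt-0130) ∧ `SelmerRankSmallImage`
(stmt-14418), at the good ordinary prime `p ≥ 5` of `exists_good_ordinary_prime_holds` (in every
rank and analytic rank). [folklore] -/
theorem squeezeUB_sel3_of_selmerRank_items (hUB : SelmerRankUB) (hSI : SelmerRankSmallImage) :
    ∀ (W : WeierstrassCurve ℚ) [W.IsElliptic] [W.IsGloballyMinimal],
      3 ≤ W.mordellWeilRank → 2 ≤ W.analyticRank →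
        ∃ (p : ℕ) (_ : Fact p.Prime), W.selmerCorank p ≤ W.analyticRank := by
  intro W _ _ _ _
  obtain ⟨p, hp, h5, hgood, hord⟩ := WeierstrassCurve.exists_good_ordinary_prime_holds W
  refine ⟨p, hp, ?_⟩
  by_cases hs : W.HasSurjectiveModNGaloisRep p
  · exact hUB W p h5 hgood hord hs
  · exact (hSI W p h5 hgood hord hs).le

/-- **WCL3 from crux `PAdicOrderComparisonR2`** (stmt-0489: `ord_T L_p = r_an` at EVERY good
ordinary prime): the equality at the good ordinary prime `p ≥ 5` of
`exists_good_ordinary_prime_holds` is the wanted inequality at one odd good ordinary prime.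
[folklore] -/
theorem squeezeUB_wcl3_of_comparison (hC : PAdicOrderComparisonR2) :
    ∀ (W : WeierstrassCurve ℚ) [W.IsElliptic] [W.IsGloballyMinimal]
      {N : ℕ} [NeZero N] (f : CuspForm (Gamma0 N) 2), IsNewformOf W f →
        3 ≤ W.mordellWeilRank → 2 ≤ W.analyticRank →
        ∃ (p : ℕ) (_ : Fact p.Prime), p ≠ 2 ∧ IsOrdinaryAt W p ∧
          (padicLFunction f (unitRoot W p : ℚ_[p])).order ≤ (W.analyticRank : ℕ∞) := by
  intro W _ _ N _ f hf _ _
  obtain ⟨p, hp, h5, hgood, hord⟩ := WeierstrassCurve.exists_good_ordinary_prime_holds W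
  exact ⟨p, hp, by omega, ⟨hgood, hord⟩, (hC W p ⟨hgood, hord⟩ f hf).le⟩

/-- **MOD from the modularity fact** `exists_isNewformOf` (every elliptic `E/ℚ` has a newform of
level `N_E`) with the PROVED `conductorNorm_pos_holds`. CONDITIONAL on that fact.
[cite: DiamondShurman2005, Thm. 8.8.3] -/
theorem squeezeUB_mod_of_fact (hmod : exists_isNewformOf) :
    ∀ (W : WeierstrassCurve ℚ) [W.IsElliptic] [W.IsGloballyMinimal],
      ∃ (N : ℕ) (_ : NeZero N) (f : CuspForm (Gamma0 N) 2), IsNewformOf W f := by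
  intro W _ _
  haveI hN : NeZero (W.conductorNorm ℤ) := ⟨(W.conductorNorm_pos_holds).ne'⟩
  obtain ⟨f, hf⟩ := hmod W
  exact ⟨W.conductorNorm ℤ, hN, f, hf⟩

/-- **SEL3 from the Kato half** (card `kato-half-at-one-prime`): the ∀-closure of Kato's corank
bound (tree fact `kato_selmerCorank_le_order_padicLFunction`: `corank Sel_{p^∞} ≤ ord_T L_p` at
every odd good ordinary prime; Kato, Astérisque 295, Thm 18.4), MOD and WCL3 give SEL3:
`corank Sel_{p^∞} ≤ ord_T L_p ≤ r_an` in `ℕ∞` at the prime of WCL3. CONDITIONAL on the Kato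
fact. [cite: Kato2004, Thm 18.4] -/
theorem squeezeUB_sel3_of_katoHalf
    (hK : ∀ (W : WeierstrassCurve ℚ) [W.IsElliptic] [W.IsGloballyMinimal] (p : ℕ) [Fact p.Prime]
      {N : ℕ} [NeZero N] {f : CuspForm (Gamma0 N) 2},
      kato_selmerCorank_le_order_padicLFunction W p (f := f))
    (hM : ∀ (W : WeierstrassCurve ℚ) [W.IsElliptic] [W.IsGloballyMinimal],
      ∃ (N : ℕ) (_ : NeZero N) (f : CuspForm (Gamma0 N) 2), IsNewformOf W f)
    (hW : ∀ (W : WeierstrassCurve ℚ) [W.IsElliptic] [W.IsGloballyMinimal]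
      {N : ℕ} [NeZero N] (f : CuspForm (Gamma0 N) 2), IsNewformOf W f →
        3 ≤ W.mordellWeilRank → 2 ≤ W.analyticRank →
        ∃ (p : ℕ) (_ : Fact p.Prime), p ≠ 2 ∧ IsOrdinaryAt W p ∧
          (padicLFunction f (unitRoot W p : ℚ_[p])).order ≤ (W.analyticRank : ℕ∞)) :
    ∀ (W : WeierstrassCurve ℚ) [W.IsElliptic] [W.IsGloballyMinimal],
      3 ≤ W.mordellWeilRank → 2 ≤ W.analyticRank →
        ∃ (p : ℕ) (_ : Fact p.Prime), W.selmerCorank p ≤ W.analyticRank := by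
  intro W _ _ h3 h2
  obtain ⟨N, hN, f, hf⟩ := hM W
  obtain ⟨p, hp, hp2, hord, hle⟩ := hW W f hf h3 h2
  have h1 : (W.selmerCorank p : ℕ∞) ≤ W.analyticRank := (hK W p hp2 hord hf).trans hle
  exact ⟨p, hp, by exact_mod_cast h1⟩

/-- **The parity ratchet** (ideator 2's `floor_three`): given Mordell–Weil parity on globally
minimal models (`Even rank ↔ Even r_an`; route Squeeze's crux `SqueezeParity`, stmt-0146, or
`PinchPrime` + Kato + p-parity inside route LeadingTerm), the cell UB3 follows from its `rank ≥ 4`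
part UB4: a curve with `rank = 3` and `2 ≤ r_an < 3` would have `r_an = 2`, of the wrong parity.
Unconditional implication. [folklore] -/
theorem squeezeUB_ub3_of_parity_of_ub4
    (hpar : ∀ (W : WeierstrassCurve ℚ) [W.IsElliptic] [W.IsGloballyMinimal],
      Even W.mordellWeilRank ↔ Even W.analyticRank)
    (hUB4 : ∀ (W : WeierstrassCurve ℚ) [W.IsElliptic] [W.IsGloballyMinimal],
      4 ≤ W.mordellWeilRank → 2 ≤ W.analyticRank → W.mordellWeilRank ≤ W.analyticRank) :
    ∀ (W : WeierstrassCurve ℚ) [W.IsElliptic] [W.IsGloballyMinimal],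
      3 ≤ W.mordellWeilRank → 2 ≤ W.analyticRank → W.mordellWeilRank ≤ W.analyticRank := by
  intro W _ _ h3 h2
  by_cases h4 : 4 ≤ W.mordellWeilRank
  · exact hUB4 W h4 h2
  · have hr : W.mordellWeilRank = 3 := by omega
    by_contra hlt
    have ha : W.analyticRank = 2 := by omega
    have hp := hpar W
    rw [hr, ha] at hp
    exact absurd (hp.mpr ⟨1, rfl⟩) (by decide)

/-- Route Squeeze's crux `SqueezeParity` (stmt-0146) supplies the parity hypothesis of
`squeezeUB_ub3_of_parity_of_ub4` (restriction to globally minimal models). [folklore] -/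
theorem squeezeUB_parity_of_squeezeParity (hpar : SqueezeParity) :
    ∀ (W : WeierstrassCurve ℚ) [W.IsElliptic] [W.IsGloballyMinimal],
      Even W.mordellWeilRank ↔ Even W.analyticRank :=
  fun W _ _ => hpar W

/-- `squeezeUB_iff_cells` under the route-LeadingTerm name of the crux (byte-identical decl).
[folklore] -/
theorem squeezeUBR2_iff_cells :
    SqueezeUBR2 ↔
      ((∀ (W : WeierstrassCurve ℚ) [W.IsElliptic] [W.IsGloballyMinimal],
          W.analyticRank ≤ 1 → W.mordellWeilRank ≤ W.analyticRank) ∧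
        ∀ (W : WeierstrassCurve ℚ) [W.IsElliptic] [W.IsGloballyMinimal],
          3 ≤ W.mordellWeilRank → 2 ≤ W.analyticRank → W.mordellWeilRank ≤ W.analyticRank) :=
  squeezeUB_iff_cells

/-- `squeezeUB_iff_cells` under the route-HigherGrossZagier name of the crux (byte-identical
decl). [folklore] -/
theorem higherGZ_squeezeUB_iff_cells :
    Summit.BirchSwinnertonDyer.BirchSwinnertonDyer.Theses.HigherGrossZagier.SqueezeUB ↔
      ((∀ (W : WeierstrassCurve ℚ) [W.IsElliptic] [W.IsGloballyMinimal],
          W.analyticRank ≤ 1 → W.mordellWeilRank ≤ W.analyticRank) ∧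
        ∀ (W : WeierstrassCurve ℚ) [W.IsElliptic] [W.IsGloballyMinimal],
          3 ≤ W.mordellWeilRank → 2 ≤ W.analyticRank → W.mordellWeilRank ≤ W.analyticRank) :=
  squeezeUB_iff_cells

end Summit.BirchSwinnertonDyer.BirchSwinnertonDyer.Theorems
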